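import Literature.Algebra.Homology.KunnethDirectSum
import Literature.Algebra.Homology.KunnethMapIsoUnbounded
import HarnessLib

/-!
# The Künneth isomorphism in direct-sum form for UNBOUNDED complexes: `Hⁿ(C ⊗ D) ≃ₗ[k] ⨁_{i+j=n} Hⁱ(C) ⊗ₖ Hʲ(D)`

Layer `Literature/Algebra/Homology` (sequel of `Algebra/Homology/KunnethDirectSum` and `KunnethMapIsoUnbounded`; one definition — the
packaged `k`-linear Künneth equivalence without boundedness binders —, 0 named facts, no instances, no notation).
`KunnethDirectSum.kunnethLinearEquiv C D a₁ b₁ a₂ b₂ n` (Weibel Thm. 3.6.3 in direct-sum form) asks `C ∈ [a₁, b₁]`, `D ∈ [a₂, b₂]`; with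
`KunnethMapIsoUnbounded.kunnethIsoOfField` (the Künneth map is an isomorphism for ANY complexes of vector spaces) the same
construction gives

* **`kunnethLinearEquivOfField C D n : (⨁ (p : {p : ℤ × ℤ // p.1 + p.2 = n}), Hᵖ¹(C) ⊗[k] Hᵖ²(D)) ≃ₗ[k] Hⁿ(C ⊗ D)`** for arbitrary
  cochain complexes `C`, `D` of `k`-vector spaces, with **`kunnethLinearEquivOfField_lof`** (`[z] ⊗ [w] ↦ [z ⊗ w]` on each summand)
  (the vanishing corollary follows as in `KunnethDirectSum.subsingleton_homology_tensorObj_of_forall`, by `LinearEquiv.subsingleton`).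

Nothing in `KunnethDirectSum.lean` is edited (its bounded `kunnethLinearEquiv` is cited, not restated). Library only (cell
`pub-hodge-ring2`, count-neutral); proves nothing about any crux, route or conjecture.

## References

* C. A. Weibel, *An introduction to homological algebra* (1994), Thm. 3.6.3. [Weibel1994]
* H. Cartan, S. Eilenberg, *Homological Algebra* (1956), VI.3, Thm. 3.1. [CartanEilenberg1956]
-/

noncomputable section

-- `GradedObject`/`HomologicalComplex₂.toGradedObject` are not reducible (as in Mathlib's `Algebra/Homology/TotalComplex.lean`).
set_option backward.isDefEq.respectTransparency false

open CategoryTheory CategoryTheory.Category CategoryTheory.Limits CategoryTheory.MonoidalCategory HomologicalComplex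
open scoped DirectSum TensorProduct

universe u

namespace Literature.Algebra.Homology

variable {k : Type u} [Field k] (C D : CochainComplex (ModuleCat.{u} k) ℤ) (n : ℤ)

/-- **The Künneth theorem over a field, direct-sum form, UNBOUNDED complexes** (Weibel Thm. 3.6.3): for arbitrary cochain
complexes `C`, `D` of `k`-vector spaces, `⨁_{i+j=n} Hⁱ(C) ⊗ₖ Hʲ(D) ≃ₗ[k] Hⁿ(C ⊗ D)`, the sum of the cross products
`[z] ⊗ [w] ↦ [z ⊗ w]` (`KunnethDirectSum.tensorObjXIsoDirectSum` composed with `KunnethMapIsoUnbounded.kunnethIsoOfField`).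
[cite: Weibel1994, Thm. 3.6.3] [cite: CartanEilenberg1956, VI.3 Thm. 3.1] -/
def kunnethLinearEquivOfField :
    TensorDirectSum (homologyZeroDifferential C) (homologyZeroDifferential D) n ≃ₗ[k]
      (HomologicalComplex.tensorObj C D).homology n :=
  ((tensorObjXIsoDirectSum (homologyZeroDifferential C) (homologyZeroDifferential D) n).symm ≪≫
    kunnethIsoOfField C D n).toLinearEquiv

/-- **On the summand `(i, j)` the unbounded Künneth equivalence is the cross product `κᵢⱼ : [z] ⊗ [w] ↦ [z ⊗ w]`.**
[cite: Weibel1994, Thm. 3.6.3] -/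
theorem kunnethLinearEquivOfField_lof (p : {p : ℤ × ℤ // p.1 + p.2 = n})
    (x : TensorSummand (homologyZeroDifferential C) (homologyZeroDifferential D) n p) :
    kunnethLinearEquivOfField C D n
        (DirectSum.lof k _ (TensorSummand (homologyZeroDifferential C) (homologyZeroDifferential D) n) p x) =
      kunnethComponent C D p.1.1 p.1.2 n p.2 x := by
  change (kunnethIsoOfField C D n).hom
      ((tensorObjXIsoDirectSum (homologyZeroDifferential C) (homologyZeroDifferential D) n).inv
        (DirectSum.lof k _ _ p x)) = _
  rw [tensorObjXIsoDirectSum_inv_lof]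
  exact congrArg (fun φ : (homologyZeroDifferential C).X p.1.1 ⊗ (homologyZeroDifferential D).X p.1.2 ⟶
      (HomologicalComplex.tensorObj C D).homology n => φ x) (ι_kunnethIsoOfField_hom C D p.1.1 p.1.2 n p.2)

end Literature.Algebra.Homology

end
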